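import Literature.NumberTheory.Automorphic.Liu2021.AppendixC.HeckeImage
import Literature.NumberTheory.DiophantineGeometry.AVIsogenyTateFreeHomProofs
import HarnessLib

/-!
# [Liu 2021, p. 133 (D.3) / p. 140] an idempotent of `End⁰(A_K)` is `d⁻¹ ×` an HONEST quasi-idempotent endomorphism `u`, `u ∘ u = d · u` (d6 DH2c core)

Topic `NumberTheory/Automorphic/Liu2021/AppendixC`; namespaces `Literature.AlgebraicGeometry.Motives.AbelianVariety` (§1, generic) and
`Literature.NumberTheory.Automorphic.Liu2021.AppendixC.Sec42Data.HeckeTranslates` (§2).  THEOREMS ONLY (no definition, no named fact, no instance,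
no `sorry`).

Print, [Liu2021] p. 133 (D.3) «we obtain an isogeny decomposition `A_K ∼ A_K^st × A_K^end`» and p. 140 «Using Hecke operators, we may find a surjective
homomorphism `ϕ : A_K → B` of abelian varieties over `E` such that the induced map `ϕ^* : H¹_B(B, ℚ) → H¹_B(A_K, ℚ)[π^∞]` is an isomorphism»: the block is
cut by a (central) idempotent `ε` of the image of the Hecke algebra in `End(A_K)_ℚ` (★ `heckeImage`), and the quotient `B` is the image of an honest
endomorphism `u` with `u ∘ u = d · u` obtained from `ε` by clearing denominators — the exact input `(u, a, hu : u ≫ u = a • u, ha : a ≠ 0)` of the tree's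
★ `Motives.AbelianVarietyQuasiIdempotentImageDual` / ★ `AbelianVarietyQuasiIdempotentImageAction` (`AbelianVariety.image u`, `toImage u`).

* §1 `AbelianVariety.exists_hom_comp_self_eq_nsmul_of_isIdempotentElem` — over a field of characteristic `0`, every idempotent `ε ∈ End⁰(A)` is
  `ε = d⁻¹ · (1 ⊗ u)` with `d ≠ 0` and `u : A ⟶ A` honest, `u ≫ u = d • u` (denominators ★ `endAlgebra.exists_eq_algebraMap_mul_of`, injectivity of
  `End A → End⁰ A` ★ `endAlgebra.of_injective_of_charZero`, Mumford §19 Thm. 3); `u` commutes with every `f : A ⟶ A` whose image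
  commutes with `ε` (`comp_comm_of_of_eq_smul_of_commute`); `rationalTateModuleMap_eq_smul_rationalTateAction` — `V_ℓ u = d · V_ℓ^ℚ ε`.
* §2 `Sec42Data.HeckeTranslates.exists_hom_of_isIdempotentElem_of_mem_center_heckeImage` — for a CENTRAL idempotent `ε` of `heckeImage K`: the honest
  `u` with `u ≫ u = d • u`, `1 ⊗ u = d · ε` commuting with `heckeImage`, whose action on `H¹_ét(A_∞)` through `[·]_K` is `d ·` that of `ε`.

DICTIONARY LINE (cell `hodgecm-mathlib`, crux `HLiu418` = stmt-HodgeConjecture-24832, d6 HOME card S2′ row 3 «the projector `u`», census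
`CENSUS-DH1-DH2.A-p09g13.md` §DH2c): with ★ DH2b `isSemisimpleRing_heckeImage_of_isSemisimpleModule` the ℚ-algebra `heckeImage K` is semisimple, so its
central idempotents are the block projectors (Wedderburn; ★ `RingTheory.Idempotents.CentralIdempotents`, blocks = `Aut(ℂ/ℚ)`-orbits by ★
`AutComplexCentralIdempotentOrbit`); this file turns the chosen block `ε` into the honest `u` of S2′.  The file moves no book (HC_CM is proved only modulo
the 7 printed citations until rung 0 closes).

## References
* [Liu2021] Y. Liu, *Fourier–Jacobi cycles and arithmetic relative trace formula*, Camb. J. Math. 9 (2021): p. 133 (D.3) (FJcycle.tex l. 5463–5470), p. 140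
  (proof of Thm. D.6 (1), l. 5626).
* [MumfordAV1970] D. Mumford, *Abelian Varieties*, §19 Thm. 3 and Cor. 2 (`End A ⊂ End⁰ A`).
-/

set_option autoImplicit false

noncomputable section

open CategoryTheory NumberField Function MulAction
open scoped TensorProduct

/-! ## §1 Idempotents of `End⁰(A)` and honest quasi-idempotent endomorphisms -/

namespace Literature.AlgebraicGeometry.Motives.AbelianVariety

universe u

variable {K : Type u} [Field K] [CharZero K] (A : AbelianVariety K)

/-- **An idempotent of `End⁰(A)` is `d⁻¹ ×` an honest endomorphism `u` with `u ≫ u = d • u`** (`char K = 0`): write `ε = d⁻¹ · (1 ⊗ u)`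
(`endAlgebra.exists_eq_algebraMap_mul_of`); then `1 ⊗ (u ≫ u) = d² ε² = d² ε = 1 ⊗ (d • u)`, and `End A → End⁰ A` is injective (Mumford §19 Thm. 3).
[cite: MumfordAV1970, §19 Thm. 3 and Cor. 2] [cite: Liu2021, p. 140 (proof of Thm. D.6 (1), FJcycle.tex l. 5626)] -/
theorem exists_hom_comp_self_eq_nsmul_of_isIdempotentElem {ε : A.endAlgebra} (hε : IsIdempotentElem ε) :
    ∃ (d : ℕ) (u : A ⟶ A), d ≠ 0 ∧ endAlgebra.of A u = (d : ℚ) • ε ∧ u ≫ u = d • u := by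
  obtain ⟨d, u, hd, hεu⟩ := endAlgebra.exists_eq_algebraMap_mul_of ε
  have hdq : (d : ℚ) ≠ 0 := Nat.cast_ne_zero.2 hd
  -- `1 ⊗ u = d · ε`
  have hu : endAlgebra.of A u = (d : ℚ) • ε := by
    rw [hεu, Algebra.smul_def, ← mul_assoc, ← map_mul, mul_inv_cancel₀ hdq, map_one, one_mul]
  refine ⟨d, u, hd, hu, ?_⟩
  -- `1 ⊗ (u ≫ u) = (d ε)² = d · (d ε) = 1 ⊗ (d • u)`, computed in the ring `End A` (`u * u = u ≫ u`, `CategoryTheory.End.mul_def`)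
  apply endAlgebra.of_injective_of_charZero (A := A)
  change endAlgebra.of A (u * u) = endAlgebra.of A (d • u)
  rw [map_mul, map_nsmul, hu, smul_mul_smul_comm, hε.eq, ← Nat.cast_smul_eq_nsmul ℚ d, smul_smul]

/-- **The honest endomorphism commutes with whatever commutes with `ε`**: if `1 ⊗ f` commutes with `ε` then `f ≫ u = u ≫ f` (injectivity of
`End A → End⁰ A`). [cite: MumfordAV1970, §19 Thm. 3 and Cor. 2] -/
theorem comp_comm_of_of_eq_smul_of_commute {ε : A.endAlgebra} {d : ℕ} {u : A ⟶ A}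
    (hu : endAlgebra.of A u = (d : ℚ) • ε) {f : A ⟶ A} (hf : Commute (endAlgebra.of A f) ε) :
    f ≫ u = u ≫ f := by
  -- in the ring `End A`: `f ≫ u = u * f`, `u ≫ f = f * u` (`CategoryTheory.End.mul_def`)
  apply endAlgebra.of_injective_of_charZero (A := A)
  have e1 : endAlgebra.of A (f ≫ u) = endAlgebra.of A u * endAlgebra.of A f := by
    rw [← map_mul]
    rfl
  have e2 : endAlgebra.of A (u ≫ f) = endAlgebra.of A f * endAlgebra.of A u := by
    rw [← map_mul]
    rfl
  rw [e1, e2, hu, smul_mul_assoc, mul_smul_comm, hf.eq]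

omit [CharZero K] in
/-- **`V_ℓ u = d · V_ℓ^ℚ ε`** on the rational Tate module (`V_ℓ^ℚ (1 ⊗ u) = V_ℓ u`, ★ `rationalTateAction_of`). [cite: MumfordAV1970, §19 Thm. 3] -/
theorem rationalTateModuleMap_eq_smul_rationalTateAction (ℓ : ℕ) [Fact ℓ.Prime] {ε : A.endAlgebra} {d : ℕ} {u : A ⟶ A}
    (hu : endAlgebra.of A u = (d : ℚ) • ε) :
    (rationalTateModuleMap ℓ u : Module.End ℚ_[ℓ] (A.rationalTateModule ℓ)) = (d : ℚ_[ℓ]) • rationalTateAction A ℓ ε := by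
  rw [← rationalTateAction_of, hu, Algebra.smul_def, map_mul, rationalTateAction_algebraMap, ← Algebra.smul_def, map_natCast]

end Literature.AlgebraicGeometry.Motives.AbelianVariety

/-! ## §2 Central idempotents of the image of the Hecke algebra -/

namespace Literature.NumberTheory.Automorphic.Liu2021.AppendixC

open Literature.AlgebraicGeometry.Motives (AbelianVariety)
open Literature.AlgebraicGeometry.Motives.AbelianVariety (rationalTateModuleMap endAlgebra rationalTateAction)

variable {F E : Type} [Field F] [NumberField F] [IsTotallyReal F] [Field E] [NumberField E] [Algebra F E]
  [IsTotallyComplex E] [Algebra.IsQuadraticExtension F E]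
variable {P5 : PropC5Data F E} {isotropicAt : ℕ → Prop}

namespace Sec42Data.HeckeTranslates

variable {C : Sec42Data P5 isotropicAt} (T : C.HeckeTranslates)

/-- **DH2c core — a central idempotent of `heckeImage K` is `d⁻¹ ×` an honest Hecke-equivariant quasi-idempotent `u : A_K ⟶ A_K`**: `d ≠ 0`,
`1 ⊗ u = d · ε`, `u ≫ u = d • u` (the input of ★ `AbelianVarietyQuasiIdempotentImageDual` / `…ImageAction`), `1 ⊗ u` commutes with the whole image,
and on `H¹_ét(A_∞)` through `[·]_K` the pull-back `ᵗV_ℓ(u)` is `d ·` the action of `ε` — so the block cut by `ε` is the `d`-eigenspace of `ᵗV_ℓ(u)`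
(«Using Hecke operators, we may find a surjective homomorphism `ϕ : A_K → B` …», `B = image u`). [cite: Liu2021, p. 133 (D.3) and p. 140 (proof of Thm. D.6 (1))]
[cite: MumfordAV1970, §19 Thm. 3 and Cor. 2] -/
theorem exists_hom_of_isIdempotentElem_of_mem_center_heckeImage (hD : T.IsogenyDescent) (K : C5.SmallLevel C.S.K₀) {ε : (C.A K).endAlgebra}
    (hεT : ε ∈ T.heckeImage hD K) (hε : IsIdempotentElem ε) (hz : ∀ x ∈ T.heckeImage hD K, x * ε = ε * x) :
    ∃ (d : ℕ) (u : C.A K ⟶ C.A K), d ≠ 0 ∧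
      endAlgebra.of (C.A K) u = (d : ℚ) • ε ∧ u ≫ u = d • u ∧
      endAlgebra.of (C.A K) u ∈ T.heckeImage hD K ∧
      (∀ x ∈ T.heckeImage hD K, x * endAlgebra.of (C.A K) u = endAlgebra.of (C.A K) u * x) ∧
      (∀ (ℓ : ℕ) [Fact ℓ.Prime] (φ : C.etaleH1 ℓ K),
        C.toTower ℓ K ((rationalTateModuleMap ℓ u).dualMap φ) = (d : ℚ_[ℓ]) • C.toTower ℓ K ((rationalTateAction (C.A K) ℓ ε).dualMap φ)) := by
  obtain ⟨d, u, hd, hu, huu⟩ := (C.A K).exists_hom_comp_self_eq_nsmul_of_isIdempotentElem hε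
  refine ⟨d, u, hd, hu, huu, ?_, fun x hx => ?_, fun ℓ _ φ => ?_⟩
  · rw [hu]
    exact Subalgebra.smul_mem _ hεT _
  · rw [hu, mul_smul_comm, smul_mul_assoc, hz x hx]
  · rw [(C.A K).rationalTateModuleMap_eq_smul_rationalTateAction ℓ hu]
    have h1 : ((d : ℚ_[ℓ]) • rationalTateAction (C.A K) ℓ ε).dualMap φ = (d : ℚ_[ℓ]) • (rationalTateAction (C.A K) ℓ ε).dualMap φ := by
      ext v
      simp only [LinearMap.dualMap_apply, LinearMap.smul_apply, map_smul, smul_eq_mul]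
    rw [h1, map_smul]

/-- In particular `u` commutes with every honest endomorphism whose image lies in `heckeImage K` — e.g. the `ψ_g` of ★ `heckeEnd_spec`
(`heckeEnd K g = m⁻¹ · (1 ⊗ ψ_g)`). [cite: Liu2021, p. 133 (D.3)] [cite: MumfordAV1970, §19 Thm. 3 and Cor. 2] -/
theorem comp_comm_of_mem_center_heckeImage (hD : T.IsogenyDescent) (K : C5.SmallLevel C.S.K₀) {ε : (C.A K).endAlgebra} {d : ℕ}
    {u : C.A K ⟶ C.A K} (hu : endAlgebra.of (C.A K) u = (d : ℚ) • ε)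
    (hz : ∀ x ∈ T.heckeImage hD K, x * ε = ε * x) {f : C.A K ⟶ C.A K} {q : ℚ} (hq : q ≠ 0)
    (hf : algebraMap ℚ (C.A K).endAlgebra q * endAlgebra.of (C.A K) f ∈ T.heckeImage hD K) : f ≫ u = u ≫ f := by
  refine (C.A K).comp_comm_of_of_eq_smul_of_commute hu ?_
  have h1 := hz _ hf
  -- cancel the unit `q`
  have hq' : IsUnit (algebraMap ℚ (C.A K).endAlgebra q) := (IsUnit.mk0 q hq).map _
  show endAlgebra.of (C.A K) f * ε = ε * endAlgebra.of (C.A K) f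
  have h2 : algebraMap ℚ (C.A K).endAlgebra q * (endAlgebra.of (C.A K) f * ε) =
      algebraMap ℚ (C.A K).endAlgebra q * (ε * endAlgebra.of (C.A K) f) :=
    calc algebraMap ℚ (C.A K).endAlgebra q * (endAlgebra.of (C.A K) f * ε)
        = (algebraMap ℚ (C.A K).endAlgebra q * endAlgebra.of (C.A K) f) * ε := (mul_assoc _ _ _).symm
      _ = ε * (algebraMap ℚ (C.A K).endAlgebra q * endAlgebra.of (C.A K) f) := h1
      _ = algebraMap ℚ (C.A K).endAlgebra q * (ε * endAlgebra.of (C.A K) f) := by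
          rw [← mul_assoc, ← Algebra.commutes q ε, mul_assoc]
  exact hq'.mul_left_cancel h2

end Sec42Data.HeckeTranslates

end Literature.NumberTheory.Automorphic.Liu2021.AppendixC

end
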